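import Summits.ABC.IUTFork.Cor312ThetaLocalLowerPrVolTuple
import Summits.ABC.IUTFork.Cor312LicenceSharpDegreeOneLemmas
import Summits.ABC.IUTFork.Cor312SlotLicenceNormConstKDegOne
import Summits.ABC.IUTFork.Thm311SigProofs
import HarnessLib

/-!
# [IUTchIII] Cor. 3.12 over the typed setting — readings (U) and (P) COINCIDE AT THE LEVEL OF THE POSSIBLE-IMAGE FAMILIES when the Θ-idele
# norms are constant on each fibre (in particular at EVERY datum over a rational point, K line, realising ideles)

PROOF-ONLY file (D-0012; 0 definitions, 0 `Prop` facts, no instance, no notation) of the abc-iut cell (branch C certificate seat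
abc-iut-C-cert-2, gen 5; row «C:PU-IMAGES-COINCIDE»). TAKES NO SIDE on [IUTchIII] Cor. 3.12 (kurims manuscript p. 173 l. 41 – p. 174
l. 19; Thm. 3.11 (i) (Ind1)(Ind2) p. 154; Step (x) p. 181; Step (xi-f) p. 184) or on the reading (U)/(P) of `−|log(Θ)|`; every statement is
about OUR typed objects (abc-iut-c312-7's frozen `Cor312.Setting`, abc-iut-c312-5's Dupuy–Hilado instance `Real.logShellsDH`,
abc-iut-c312-7's `Real.settingPrVolSharp`, this seat's gen-3 `Setting.thetaSlotImages` / `thetaSlotHull` / `SlotLicence` / `negLogThetaSlot`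
/ `SlotStatement`, `Cor312SlotHull.lean`).

THE TWO READINGS. (U) (the cell's frozen typing): `Setting.possibleImages` = translates of the (Ind3)-region by the group GENERATED by the
(Ind1)-families (capsule permutations, Dupuy–Hilado §4.7) and the (Ind2)-families (independent `Ism` per summand and factor, §4.9). (P)
(Dupuy–Hilado §4.11–4.12, `U_Θ^slot`): `Setting.thetaSlotImages` = translates by (Ind2)-families ONLY. In general (P) ⊊ (U).

THIS FILE: when the Θ-ideles `t_{Θ,i,x}` have CONSTANT NORM on each fibre `{x | p}` (hΘ), the two families ARE EQUAL — so every
derived object coincides: hulls, licences, hull-definedness, local Θ-volumes, `−|log(Θ)|`, the typed Statement.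
* §1 (any setting) `Setting.thetaSlotHull_eq_thetaHull_of_images` … `slotStatement_iff_statement_of_images`: the transfer lemmas from an
  equality of the image families (pure unfolding).
* §2 the five group-bookkeeping hypotheses (HS)(HS′)(HN)(HI)(HI′) of abc-iut-c312-1's `LogShells.image_closure_eq` DISCHARGED for the
  Dupuy–Hilado instance `Real.logShellsDH` (`stripAut = {1}`; `Real.ismDH` = bicontinuous shell-preserving `ℚ`-linear automorphisms at
  finite places / `{±1}` at infinite ones — closed under composition and inverse): `Real.mul_mem_ismDH`, `Real.inv_mem_ismDH`, ….
* §3 **`Real.possibleImages_settingPrVolSharp_eq_thetaSlotImages`** (ANY pilot datum `X`, context binders, q-ideles; Θ-ideles `t ≠ 0` with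
  (hΘ)): `image_closure_eq` writes every possible image as `Φ₂(Φ₁(R))` with `Φ₁` an (Ind1)-family — a capsule permutation `σ` at each label
  (abc-iut-c312-5 `Real.mem_Ind1_logShellsDH_iff`) — and `Φ₂` an (Ind2)-family; and `σ` FIXES the sharp (Ind3)-region `R` under (hΘ)
  (`Real.permute_image_thetaRegion3_settingPrVolSharp_eq_of_norm_const`: abc-iut-s2-p6's closed form `permute_image_thetaRegion3_settingPrVolSharp`
  puts `ι_{σ(last)}(t_{Θ,j,v_{σ(last)}})·(R_I)^∼` in each summand, and the slot-twisted box depends on `‖t‖` ONLY — abc-iut-w5-d204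
  `mem_iota_smul_normalizedPacket_iff`). Corollaries `thetaSlotHull_settingPrVolSharp_eq_thetaHull`, `slotLicence_iff_licence_settingPrVolSharp_of_norm_const'`
  (second route to this seat's gen-4 p475870), `negLogThetaSlot_settingPrVolSharp_eq_negLogTheta`, `slotStatement_iff_statement_settingPrVolSharp`.
* §4 **K RECORD LINE at `d_mod = 1`**: `Cor312Prov.possibleImages_eq_thetaSlotImages_settingPrVolSharp_pilotDataOfK_of_finrank_eq_one` — at
  abc-iut-C-cert-3's `pilotDataOfK D K` with ANY realising Θ-ideles (gen 4 `norm_realising_eq_of_finrank_eq_one`), ANY q-ideles and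
  `[F_mod : ℚ] = 1`: (U) = (P) as families; so at EVERY TABULATED DATUM (all rational) every reading-(P) theorem about OUR objects (abc-iut-s2-p7
  `Cor312ThetaSlotExactK`, this seat's exact slot deciders `Cor312SlotLicenceExactContentK`) is a reading-(U) theorem, and conversely.

HONEST SCOPE: identities between OUR typed objects under a STATED norm-constancy hypothesis; at `d_mod ≥ 2` (two places of unequal Θ-norm
over one prime) (U) and (P) remain distinct readings (abc-iut-c312-d1 `TensorPacketSlotTwists`: the hull of the union is governed by the LEAST
divisible Θ-value); nothing here identifies the author's intended hull or bears on the printed GLOBAL inequality; decided-as-typed ≠ in print;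
typed ≠ proved (this: proved). [cite: Mochizuki2012, IUTchIII Thm. 3.11 (i) p. 154, Cor. 3.12 p. 173–174, Step (x) p. 181, Step (xi-f) p. 184,
Rmk. 3.9.5 (i) p. 127; IUTchI §0 p. 33] [cite: DupuyHilado2025, §4.7, §4.9, §4.11, §4.12] [claim: Mochizuki2012, status: disputed] for every IUT
sentence quoted.
-/

noncomputable section

open Set Function NumberField IsDedekindDomain
open scoped Pointwise

namespace Summit.ABC.IUTFork

/-! ## §1. Any setting: transfer of every derived object along an equality of the image families -/

namespace Cor312.Setting

open Thm311 Literature.IUT.LogThetaLattice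

variable {T : ThetaIndex} {S : Situation T} (P : Setting S)
  (h : ∀ (j : T.Label) (vQ : T.VQ), P.possibleImages j vQ = P.thetaSlotImages j vQ)

include h

/-- Equal image families ⇒ `thetaSlotHull = thetaHull`. [cite: Mochizuki2012, IUTchIII Rmk. 3.9.5 (i) p. 127] [claim: Mochizuki2012, status: disputed] -/
theorem thetaSlotHull_eq_thetaHull_of_images (j : T.Label) (vQ : T.VQ) : P.thetaSlotHull j vQ = P.thetaHull j vQ := by
  unfold thetaSlotHull thetaHull
  rw [h]

/-- Equal image families ⇒ `SlotHullDefined ↔ HullDefined`. [claim: Mochizuki2012, status: disputed] -/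
theorem slotHullDefined_iff_hullDefined_of_images (j : T.Label) (vQ : T.VQ) : P.SlotHullDefined j vQ ↔ P.HullDefined j vQ := by
  unfold SlotHullDefined HullDefined
  rw [h]

/-- Equal image families ⇒ `SlotLicence ↔ Licence`. [cite: Mochizuki2012, IUTchIII Cor. 3.12 Step (xi-f) p. 184] [claim: Mochizuki2012, status: disputed] -/
theorem slotLicence_iff_licence_of_images : P.SlotLicence ↔ Thm311ToCor312.Licence P := by
  unfold SlotLicence Thm311ToCor312.Licence
  simp only [P.thetaSlotHull_eq_thetaHull_of_images h]

/-- Equal image families ⇒ `thetaSlotLocal = thetaLocal`. [cite: Mochizuki2012, IUTchIII Cor. 3.12 Step (x) p. 181] [claim: Mochizuki2012, status: disputed] -/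
theorem thetaSlotLocal_eq_thetaLocal_of_images (j : T.Label) (vQ : T.VQ) : P.thetaSlotLocal j vQ = P.thetaLocal j vQ := by
  unfold thetaSlotLocal thetaLocal
  by_cases hd : P.HullDefined j vQ
  · rw [if_pos ((P.slotHullDefined_iff_hullDefined_of_images h j vQ).2 hd), if_pos hd,
      P.thetaSlotHull_eq_thetaHull_of_images h j vQ]
  · rw [if_neg (fun hs => hd ((P.slotHullDefined_iff_hullDefined_of_images h j vQ).1 hs)), if_neg hd]

/-- Equal image families ⇒ `ThetaSlotFinite ↔ ThetaFinite`. [claim: Mochizuki2012, status: disputed] -/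
theorem thetaSlotFinite_iff_thetaFinite_of_images : P.ThetaSlotFinite ↔ P.ThetaFinite := by
  unfold ThetaSlotFinite ThetaFinite
  simp only [P.thetaSlotLocal_eq_thetaLocal_of_images h]

/-- Equal image families ⇒ `negLogThetaSlot = negLogTheta`. [cite: Mochizuki2012, IUTchIII Cor. 3.12 p. 174 l. 16–18, Step (x) p. 181] [claim: Mochizuki2012, status: disputed] -/
theorem negLogThetaSlot_eq_negLogTheta_of_images : P.negLogThetaSlot = P.negLogTheta := by
  unfold negLogThetaSlot negLogTheta
  by_cases hf : P.ThetaFinite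
  · rw [if_pos ((P.thetaSlotFinite_iff_thetaFinite_of_images h).2 hf), if_pos hf]
    simp only [P.thetaSlotLocal_eq_thetaLocal_of_images h]
  · rw [if_neg (fun hs => hf ((P.thetaSlotFinite_iff_thetaFinite_of_images h).1 hs)), if_neg hf]

/-- Equal image families ⇒ `SlotStatement ↔ Statement`. [cite: Mochizuki2012, IUTchIII Cor. 3.12 p. 174 l. 16–18] [claim: Mochizuki2012, status: disputed] -/
theorem slotStatement_iff_statement_of_images : P.SlotStatement ↔ P.Statement := by
  unfold SlotStatement Statement
  rw [P.negLogThetaSlot_eq_negLogTheta_of_images h]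

end Cor312.Setting

/-! ## §2. The Dupuy–Hilado instance: (Ind1)/(Ind2) group bookkeeping — the hypotheses of `image_closure_eq` discharged -/

namespace Thm311.Real

open Cor312 Cor312.Setting Cor312Vol Literature.IUT.LogThetaLattice Literature.IUT.LogVolume
  Literature.NumberTheory.NumberFields Literature.NumberTheory.GaloisRepresentations.Ultrametric

section DH

variable {F : Type} [Field F] [NumberField F] (X : PilotData F) (logv : PadicLogs F)

/-- **(HI)**: `Real.ismDH` is closed under composition (finite places: bicontinuous `ℚ`-linear automorphisms with `φ(I_v) = I_v`; infinite
places: `{1, −1}`). [cite: DupuyHilado2025, §4.9] -/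
theorem mul_mem_ismDH : ∀ (x : Place F), ∀ a ∈ ismDH logv x, ∀ b ∈ ismDH logv x, a * b ∈ ismDH logv x
  | .inl w => by
    intro a ha b hb
    simp only [ismDH, Set.mem_insert_iff, Set.mem_singleton_iff] at ha hb ⊢
    rcases ha with rfl | rfl <;> rcases hb with rfl | rfl
    · exact Or.inl rfl
    · exact Or.inr rfl
    · exact Or.inr (LinearEquiv.ext fun x => rfl)
    · exact Or.inl (LinearEquiv.ext fun x => neg_neg x)
  | .inr v => by
    rintro a ⟨ha1, ha2, ha3⟩ b ⟨hb1, hb2, hb3⟩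
    refine ⟨?_, ?_, ?_⟩
    · show Continuous fun z => a (b z)
      exact ha1.comp hb1
    · show Continuous fun z => b.symm (a.symm z)
      exact hb2.comp ha2
    · show (⇑a ∘ ⇑b) '' shell logv (.inr v) = shell logv (.inr v)
      rw [Set.image_comp, hb3, ha3]

/-- **(HI′)**: `Real.ismDH` is closed under inverse. [cite: DupuyHilado2025, §4.9] -/
theorem inv_mem_ismDH : ∀ (x : Place F), ∀ a ∈ ismDH logv x, a⁻¹ ∈ ismDH logv x
  | .inl w => by
    intro a ha
    simp only [ismDH, Set.mem_insert_iff, Set.mem_singleton_iff] at ha ⊢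
    rcases ha with rfl | rfl
    · exact Or.inl rfl
    · exact Or.inr (LinearEquiv.ext fun x => rfl)
  | .inr v => by
    rintro a ⟨ha1, ha2, ha3⟩
    refine ⟨ha2, ?_, ?_⟩
    · show Continuous fun z => a.symm.symm z
      simpa only [LinearEquiv.symm_symm] using ha1
    · show a.symm '' shell logv (.inr v) = shell logv (.inr v)
      conv_lhs => rw [← ha3]
      rw [Set.image_image]
      simp only [LinearEquiv.symm_apply_apply, Set.image_id']

/-- (HS): the trivialised strip slot `{1}` is closed under composition. [cite: DupuyHilado2025, §4.7] -/
theorem mul_mem_stripAutDH (x : Place F) : ∀ a ∈ stripAutDH x, ∀ b ∈ stripAutDH x, a * b ∈ stripAutDH x := by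
  intro a ha b hb
  simp only [stripAutDH, Set.mem_singleton_iff] at ha hb ⊢
  subst ha; subst hb
  rfl

/-- (HS′): the trivialised strip slot `{1}` is closed under inverse. [cite: DupuyHilado2025, §4.7] -/
theorem inv_mem_stripAutDH (x : Place F) : ∀ a ∈ stripAutDH x, a⁻¹ ∈ stripAutDH x := by
  intro a ha
  simp only [stripAutDH, Set.mem_singleton_iff] at ha ⊢
  subst ha
  rfl

/-- (HN): the trivialised strip slot normalises Ism (conjugation by `1`). [cite: DupuyHilado2025, §4.7, §4.9] -/
theorem conj_mem_ismDH_of_mem_stripAutDH (x : Place F) :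
    ∀ a ∈ stripAutDH x, ∀ g ∈ ismDH logv x, a * g * a⁻¹ ∈ ismDH logv x := by
  intro a ha g hg
  simp only [stripAutDH, Set.mem_singleton_iff] at ha
  subst ha
  have h1 : (LinearEquiv.refl ℚ (Carrier x)) * g * (LinearEquiv.refl ℚ (Carrier x))⁻¹ = g := by
    ext z; rfl
  rw [h1]
  exact hg

end DH

/-! ## §3. The sharp assembled real setting: under norm constancy (Ind1) fixes the (Ind3)-region, so (U) = (P) -/

section Assembled

variable {F : Type} [Field F] [NumberField F] (X : PilotData F) {logv : PadicLogs F} (hlog : LogvAnalytic logv)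
  (M : Type) [Field M] [NumberField M]
  (archPk : ∀ (j : (thetaIndex X).Label) (vQ : (thetaIndex X).VQ), Set ((logShellsDH X logv).Packet j vQ))
  (archSub : ∀ (j : (thetaIndex X).Label) (v : (thetaIndex X).V),
    Set ((logShellsDH X logv).Packet j ((thetaIndex X).over v)))
  (Ψ : ℤ → ∀ v : (thetaIndex X).V, v ∈ (thetaIndex X).Vbad → Set ((logShellsDH X logv).StarPacket v))
  (act : ℤ → ∀ v : (thetaIndex X).V, v ∈ (thetaIndex X).Vbad →
    (logShellsDH X logv).StarPacket v → Module.End ℚ ((logShellsDH X logv).StarPacket v))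
  (Mmod : ℤ → ∀ j : (thetaIndex X).LabelStar, Set ((logShellsDH X logv).GlobalPacket j.1))
  (region : ℤ → ∀ j : (thetaIndex X).LabelStar, FinDivisor M → ∀ vQ : (thetaIndex X).VQ,
    Set ((logShellsDH X logv).Packet j.1 vQ))
  (n : ℤ) {HT : Type} {LogLink : HT → HT → Type} {IsFull : ∀ {s t : HT}, LogLink s t → Prop}
  (lat : LGPGaussianLogThetaLattice LogLink IsFull)
  {Frd : Type} {IsoF : Frd → Frd → Type} {Ob : Frd → Type} {realify : Frd → Frd} {Strip : Type}
  {IsoS : Strip → Strip → Type} {Mv : ∀ v : (thetaIndex X).V, v ∈ (thetaIndex X).Vbad → Type}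
  [∀ v h, Monoid (Mv v h)]
  (sig : GlobalLGPFrobenioidSignature (thetaIndex X).lstar (thetaIndex X).V (· ∈ (thetaIndex X).Vbad)
    Frd IsoF Ob realify Strip IsoS Mv)
  (split : SplittingMonoids Mv) {ObΔ : Type} {N : ∀ v : (thetaIndex X).V, v ∈ (thetaIndex X).Vbad → Type}
  [∀ v h, Monoid (N v h)] (qData : QPilotData ObΔ N)
  (tq : ∀ (pp : Nat.Primes) (x : (thetaIndex X).Fibre (.inr pp)),
    haveI : Fact (pp : ℕ).Prime := ⟨pp.2⟩; kOf X pp.1 x)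
  (t : ∀ (pp : Nat.Primes) (_ : Fin X.lstar) (x : (thetaIndex X).Fibre (.inr pp)),
    haveI : Fact (pp : ℕ).Prime := ⟨pp.2⟩; kOf X pp.1 x)
  (htq0 : ∀ pp x, tq pp x ≠ 0)
  (htq1 : ∀ (pp : Nat.Primes) (x : (thetaIndex X).Fibre (.inr pp)),
    haveI : Fact (pp : ℕ).Prime := ⟨pp.2⟩; placeOf X pp.1 x ∉ X.S → ‖tq pp x‖ = 1)

/-- Under norm constancy on the fibre, the label ideles at two places over `p` have the same norm. [folklore] -/
theorem norm_labelIdele_eq_of_norm_const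
    (hΘ : ∀ (pp : Nat.Primes) (i : Fin X.lstar) (x y : (thetaIndex X).Fibre (.inr pp)), ‖t pp i x‖ = ‖t pp i y‖)
    (pp : Nat.Primes) (j : (thetaIndex X).Label) (x y : (thetaIndex X).Fibre (.inr pp)) :
    haveI : Fact (pp : ℕ).Prime := ⟨pp.2⟩; ‖labelIdele X t pp j x‖ = ‖labelIdele X t pp j y‖ := by
  unfold labelIdele
  split_ifs
  · exact hΘ pp _ x y
  · rw [norm_one, norm_one]

/-- **A capsule permutation FIXES the sharp (Ind3)-region when the Θ-norms are constant on the fibre** (abc-iut-s2-p6's closed form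
`permute_image_thetaRegion3_settingPrVolSharp` + abc-iut-c312-d1's `iota_smul_normalizedPacket_eq_of_norm_eq`: a slot-twisted box depends only on
the norm of the twisting idele; at `∞` both sides are everything). [cite: DupuyHilado2025, §4.7, §3.9] [claim: Mochizuki2012, status: disputed] -/
theorem permute_image_thetaRegion3_settingPrVolSharp_eq_of_norm_const (ht0 : ∀ pp i x, t pp i x ≠ 0)
    (hΘ : ∀ (pp : Nat.Primes) (i : Fin X.lstar) (x y : (thetaIndex X).Fibre (.inr pp)), ‖t pp i x‖ = ‖t pp i y‖)
    (j : (thetaIndex X).Label) (vQ : (thetaIndex X).VQ) (σ : Equiv.Perm ((thetaIndex X).Caps j)) :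
    (logShellsDH X logv).permute j vQ σ ''
        (settingPrVolSharp X hlog M archPk archSub Ψ act Mmod region n lat sig split qData tq t htq0 htq1).thetaRegion3 j vQ =
      (settingPrVolSharp X hlog M archPk archSub Ψ act Mmod region n lat sig split qData tq t htq0 htq1).thetaRegion3 j vQ := by
  rcases vQ with u | pp
  · rw [thetaRegion3_settingPrVolSharp_eq X hlog M archPk archSub Ψ act Mmod region n lat sig split qData t tq htq0 htq1 0 j (.inl u),
      thetaRegion_settingPrVolSharp_inl X hlog M archPk archSub Ψ act Mmod region n lat sig split qData t tq htq0 htq1 0 j u]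
    exact Set.image_univ_of_surjective ((logShellsDH X logv).permute j (.inl u) σ).surjective
  · haveI : Fact (pp : ℕ).Prime := ⟨pp.2⟩
    haveI : Nonempty ((thetaIndex X).Caps j) := ⟨σ (Fin.last _)⟩
    rw [permute_image_thetaRegion3_settingPrVolSharp, thetaRegion3_settingPrVolSharp_eq_preimage_pi]
    congr 1
    refine Set.pi_congr rfl fun e _ => ?_
    exact Literature.IUT.LogVolume.iota_smul_normalizedPacket_eq_of_norm_eq (pp : ℕ) ((presAt X hlog pp).kk e)
      (DFac (pp : ℕ) ((presAt X hlog pp).kk e)) (dEquiv (pp : ℕ) ((presAt X hlog pp).kk e)) (σ (Fin.last _)) (Fin.last _)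
      (labelIdele_ne_zero X t ht0 pp j _) (norm_labelIdele_eq_of_norm_const X t hΘ pp j _ _)

/-- **(U) = (P) AS IMAGE FAMILIES under norm constancy**: at abc-iut-c312-7's sharp assembled real setting (ANY pilot datum, context binders,
q-ideles; Θ-ideles `t ≠ 0` of constant norm on each fibre), the (Ind1)(Ind2)-orbit of the (Ind3)-region at every `(j, v_ℚ)` IS its (Ind2)-orbit:
`possibleImages = thetaSlotImages`. [cite: Mochizuki2012, IUTchIII Thm. 3.11 (i) p. 154, Cor. 3.12 p. 173–174] [cite: DupuyHilado2025, §4.7, §4.11]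
[claim: Mochizuki2012, status: disputed] -/
theorem possibleImages_settingPrVolSharp_eq_thetaSlotImages (ht0 : ∀ pp i x, t pp i x ≠ 0)
    (hΘ : ∀ (pp : Nat.Primes) (i : Fin X.lstar) (x y : (thetaIndex X).Fibre (.inr pp)), ‖t pp i x‖ = ‖t pp i y‖)
    (j : (thetaIndex X).Label) (vQ : (thetaIndex X).VQ) :
    (settingPrVolSharp X hlog M archPk archSub Ψ act Mmod region n lat sig split qData tq t htq0 htq1).possibleImages j vQ =
      (settingPrVolSharp X hlog M archPk archSub Ψ act Mmod region n lat sig split qData tq t htq0 htq1).thetaSlotImages j vQ := by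
  set P := settingPrVolSharp X hlog M archPk archSub Ψ act Mmod region n lat sig split qData tq t htq0 htq1 with hPdef
  have key := LogShells.image_closure_eq (L := logShellsDH X logv)
    (fun x => mul_mem_stripAutDH x) (fun x => inv_mem_stripAutDH x) (fun x => conj_mem_ismDH_of_mem_stripAutDH logv x)
    (fun x => mul_mem_ismDH logv x) (fun x => inv_mem_ismDH logv x) j vQ (P.thetaRegion3 j vQ)
  have hL : P.possibleImages j vQ =
      {A | ∃ Φ ∈ Subgroup.closure ((logShellsDH X logv).Ind1Family ∪ (logShellsDH X logv).Ind2Family), A = Φ j vQ '' P.thetaRegion3 j vQ} :=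
    rfl
  rw [hL, key]
  ext A
  constructor
  · rintro ⟨Φ₁, h₁, Φ₂, h₂, rfl⟩
    obtain ⟨σ, hσ⟩ := (mem_Ind1_logShellsDH_iff X logv j (Φ₁ j)).mp (h₁ j)
    refine ⟨Φ₂, h₂, ?_⟩
    rw [hσ vQ, hPdef, permute_image_thetaRegion3_settingPrVolSharp_eq_of_norm_const X hlog M archPk archSub Ψ act Mmod region n lat
      sig split qData tq t htq0 htq1 ht0 hΘ j vQ σ]
    rfl
  · rintro ⟨Φ₂, h₂, rfl⟩
    refine ⟨1, LogShells.one_mem_Ind1Family, Φ₂, h₂, ?_⟩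
    show Φ₂ j vQ '' P.thetaRegion3 j vQ = Φ₂ j vQ '' ((LinearEquiv.refl ℚ _) '' P.thetaRegion3 j vQ)
    simp only [LinearEquiv.refl_apply, Set.image_id']

/-- Hence **`thetaSlotHull = thetaHull`** at the sharp setting under norm constancy. [cite: Mochizuki2012, IUTchIII Rmk. 3.9.5 (i) p. 127]
[claim: Mochizuki2012, status: disputed] -/
theorem thetaSlotHull_settingPrVolSharp_eq_thetaHull (ht0 : ∀ pp i x, t pp i x ≠ 0)
    (hΘ : ∀ (pp : Nat.Primes) (i : Fin X.lstar) (x y : (thetaIndex X).Fibre (.inr pp)), ‖t pp i x‖ = ‖t pp i y‖)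
    (j : (thetaIndex X).Label) (vQ : (thetaIndex X).VQ) :
    (settingPrVolSharp X hlog M archPk archSub Ψ act Mmod region n lat sig split qData tq t htq0 htq1).thetaSlotHull j vQ =
      (settingPrVolSharp X hlog M archPk archSub Ψ act Mmod region n lat sig split qData tq t htq0 htq1).thetaHull j vQ :=
  Cor312.Setting.thetaSlotHull_eq_thetaHull_of_images _
    (possibleImages_settingPrVolSharp_eq_thetaSlotImages X hlog M archPk archSub Ψ act Mmod region n lat sig split qData tq t htq0 htq1
      ht0 hΘ) j vQ

/-- Hence **`SlotLicence ↔ Licence`** at the sharp setting under norm constancy — a second route to this seat's gen-4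
`slotLicence_iff_licence_settingPrVolSharp_of_norm_const` (p475870), now from the equality of the image families.
[cite: Mochizuki2012, IUTchIII Cor. 3.12 Step (xi-f) p. 184] [claim: Mochizuki2012, status: disputed] -/
theorem slotLicence_iff_licence_settingPrVolSharp_of_norm_const' (ht0 : ∀ pp i x, t pp i x ≠ 0)
    (hΘ : ∀ (pp : Nat.Primes) (i : Fin X.lstar) (x y : (thetaIndex X).Fibre (.inr pp)), ‖t pp i x‖ = ‖t pp i y‖) :
    (settingPrVolSharp X hlog M archPk archSub Ψ act Mmod region n lat sig split qData tq t htq0 htq1).SlotLicence ↔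
      Thm311ToCor312.Licence (settingPrVolSharp X hlog M archPk archSub Ψ act Mmod region n lat sig split qData tq t htq0 htq1) :=
  Cor312.Setting.slotLicence_iff_licence_of_images _
    (possibleImages_settingPrVolSharp_eq_thetaSlotImages X hlog M archPk archSub Ψ act Mmod region n lat sig split qData tq t htq0 htq1
      ht0 hΘ)

/-- Hence **`−|log(Θ)|_(P) = −|log(Θ)|_(U)`** at the sharp setting under norm constancy: `negLogThetaSlot = negLogTheta`.
[cite: Mochizuki2012, IUTchIII Cor. 3.12 p. 174 l. 16–18, Step (x) p. 181] [claim: Mochizuki2012, status: disputed] -/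
theorem negLogThetaSlot_settingPrVolSharp_eq_negLogTheta (ht0 : ∀ pp i x, t pp i x ≠ 0)
    (hΘ : ∀ (pp : Nat.Primes) (i : Fin X.lstar) (x y : (thetaIndex X).Fibre (.inr pp)), ‖t pp i x‖ = ‖t pp i y‖) :
    (settingPrVolSharp X hlog M archPk archSub Ψ act Mmod region n lat sig split qData tq t htq0 htq1).negLogThetaSlot =
      (settingPrVolSharp X hlog M archPk archSub Ψ act Mmod region n lat sig split qData tq t htq0 htq1).negLogTheta :=
  Cor312.Setting.negLogThetaSlot_eq_negLogTheta_of_images _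
    (possibleImages_settingPrVolSharp_eq_thetaSlotImages X hlog M archPk archSub Ψ act Mmod region n lat sig split qData tq t htq0 htq1
      ht0 hΘ)

/-- Hence **`SlotStatement ↔ Statement`** (the typed Corollary 3.12 in either reading) at the sharp setting under norm constancy.
[cite: Mochizuki2012, IUTchIII Cor. 3.12 p. 174 l. 16–18] [claim: Mochizuki2012, status: disputed] -/
theorem slotStatement_iff_statement_settingPrVolSharp (ht0 : ∀ pp i x, t pp i x ≠ 0)
    (hΘ : ∀ (pp : Nat.Primes) (i : Fin X.lstar) (x y : (thetaIndex X).Fibre (.inr pp)), ‖t pp i x‖ = ‖t pp i y‖) :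
    (settingPrVolSharp X hlog M archPk archSub Ψ act Mmod region n lat sig split qData tq t htq0 htq1).SlotStatement ↔
      (settingPrVolSharp X hlog M archPk archSub Ψ act Mmod region n lat sig split qData tq t htq0 htq1).Statement :=
  Cor312.Setting.slotStatement_iff_statement_of_images _
    (possibleImages_settingPrVolSharp_eq_thetaSlotImages X hlog M archPk archSub Ψ act Mmod region n lat sig split qData tq t htq0 htq1
      ht0 hΘ)

end Assembled

end Thm311.Real

/-! ## §4. The K record line at `d_mod = 1`: realising Θ-ideles have constant norm on each fibre, so (U) = (P) there -/

namespace Cor312Prov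

open Thm311 Thm311.Real Cor312 Cor312Vol Literature.IUT.LogThetaLattice Literature.IUT.LogVolume
  Literature.IUT.HodgeTheaters Literature.NumberTheory.NumberFields

variable {F K Fbar : Type} [Field F] [NumberField F] [Field K] [NumberField K] [Algebra F K] [Field Fbar]
  [Algebra F Fbar] [Algebra K Fbar] {E : WeierstrassCurve F} [E.IsElliptic] {l : ℕ} {Pb : BadPlacePredicates K}
  (D : InitialThetaData F K Fbar E l Pb)
  (t : ∀ (pp : Nat.Primes) (_ : Fin (pilotDataOfK D K).lstar) (x : (thetaIndex (pilotDataOfK D K)).Fibre (.inr pp)),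
    haveI : Fact (pp : ℕ).Prime := ⟨pp.2⟩; kOf (pilotDataOfK D K) pp.1 x)
  {logv : PadicLogs K} (hlog : LogvAnalytic logv)
  (M : Type) [Field M] [NumberField M]
  (archPk : ∀ (j : (thetaIndex (pilotDataOfK D K)).Label) (vQ : (thetaIndex (pilotDataOfK D K)).VQ),
    Set ((logShellsDH (pilotDataOfK D K) logv).Packet j vQ))
  (archSub : ∀ (j : (thetaIndex (pilotDataOfK D K)).Label) (v : (thetaIndex (pilotDataOfK D K)).V),
    Set ((logShellsDH (pilotDataOfK D K) logv).Packet j ((thetaIndex (pilotDataOfK D K)).over v)))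
  (Ψ : ℤ → ∀ v : (thetaIndex (pilotDataOfK D K)).V, v ∈ (thetaIndex (pilotDataOfK D K)).Vbad →
    Set ((logShellsDH (pilotDataOfK D K) logv).StarPacket v))
  (act : ℤ → ∀ v : (thetaIndex (pilotDataOfK D K)).V, v ∈ (thetaIndex (pilotDataOfK D K)).Vbad →
    (logShellsDH (pilotDataOfK D K) logv).StarPacket v → Module.End ℚ ((logShellsDH (pilotDataOfK D K) logv).StarPacket v))
  (Mmod : ℤ → ∀ j : (thetaIndex (pilotDataOfK D K)).LabelStar, Set ((logShellsDH (pilotDataOfK D K) logv).GlobalPacket j.1))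
  (region : ℤ → ∀ j : (thetaIndex (pilotDataOfK D K)).LabelStar, FinDivisor M → ∀ vQ : (thetaIndex (pilotDataOfK D K)).VQ,
    Set ((logShellsDH (pilotDataOfK D K) logv).Packet j.1 vQ))
  (n : ℤ) {HT : Type} {LogLink : HT → HT → Type} {IsFull : ∀ {s t : HT}, LogLink s t → Prop}
  (lat : LGPGaussianLogThetaLattice LogLink IsFull)
  {Frd : Type} {IsoF : Frd → Frd → Type} {Ob : Frd → Type} {realify : Frd → Frd} {Strip : Type}
  {IsoS : Strip → Strip → Type}
  {Mv : ∀ v : (thetaIndex (pilotDataOfK D K)).V, v ∈ (thetaIndex (pilotDataOfK D K)).Vbad → Type} [∀ v h, Monoid (Mv v h)]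
  (sig : GlobalLGPFrobenioidSignature (thetaIndex (pilotDataOfK D K)).lstar (thetaIndex (pilotDataOfK D K)).V
    (· ∈ (thetaIndex (pilotDataOfK D K)).Vbad) Frd IsoF Ob realify Strip IsoS Mv)
  (split : SplittingMonoids Mv) {ObΔ : Type}
  {N : ∀ v : (thetaIndex (pilotDataOfK D K)).V, v ∈ (thetaIndex (pilotDataOfK D K)).Vbad → Type} [∀ v h, Monoid (N v h)]
  (qData : QPilotData ObΔ N)
  (tq : ∀ (pp : Nat.Primes) (x : (thetaIndex (pilotDataOfK D K)).Fibre (.inr pp)),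
    haveI : Fact (pp : ℕ).Prime := ⟨pp.2⟩; kOf (pilotDataOfK D K) pp.1 x)
  (htq0 : ∀ pp x, tq pp x ≠ 0)
  (htq1 : ∀ (pp : Nat.Primes) (x : (thetaIndex (pilotDataOfK D K)).Fibre (.inr pp)),
    haveI : Fact (pp : ℕ).Prime := ⟨pp.2⟩; placeOf (pilotDataOfK D K) pp.1 x ∉ (pilotDataOfK D K).S → ‖tq pp x‖ = 1)

/-- **THE K RECORD LINE AT `d_mod = 1`: (U) = (P) as image families.** At abc-iut-C-cert-3's `K`-level pilot datum `pilotDataOfK D K` with ANY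
realising Θ-ideles `t ≠ 0` (given idele data `r`), ANY q-ideles and context binders, when `[F_mod : ℚ] = 1` (every rational point):
`possibleImages = thetaSlotImages` at every `(j, v_ℚ)` — so hulls, licences, `−|log(Θ)|` and the typed Statement coincide in the two readings
(§1 transfer lemmas). [cite: Mochizuki2012, IUTchIII Thm. 3.11 (i) p. 154, Cor. 3.12 p. 173–174; IUTchI Ex. 3.2 (iv) p. 71] [cite: DupuyHilado2025,
§3.4, §4.7, §4.11–4.12] [claim: Mochizuki2012, status: disputed] -/
theorem possibleImages_eq_thetaSlotImages_settingPrVolSharp_pilotDataOfK_of_finrank_eq_one (r : ThetaData.IdeleData D)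
    (ht0 : ∀ pp i x, t pp i x ≠ 0)
    (hT : ∀ (pp : Nat.Primes) (i : Fin (pilotDataOfK D K).lstar) (x : (thetaIndex (pilotDataOfK D K)).Fibre (.inr pp)),
      haveI : Fact (pp : ℕ).Prime := ⟨pp.2⟩
      Real.log ‖t pp i x‖ = -((pilotDataOfK D K).thetaPilot i (placeOf (pilotDataOfK D K) pp.1 x)) *
        logNorm K (placeOf (pilotDataOfK D K) pp.1 x) / localDegree K (placeOf (pilotDataOfK D K) pp.1 x))
    (hF : Module.finrank ℚ (fieldOfModuli E) = 1)
    (j : (thetaIndex (pilotDataOfK D K)).Label) (vQ : (thetaIndex (pilotDataOfK D K)).VQ) :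
    (settingPrVolSharp (pilotDataOfK D K) hlog M archPk archSub Ψ act Mmod region n lat sig split qData tq t htq0 htq1).possibleImages j vQ =
      (settingPrVolSharp (pilotDataOfK D K) hlog M archPk archSub Ψ act Mmod region n lat sig split qData tq t htq0 htq1).thetaSlotImages j vQ :=
  possibleImages_settingPrVolSharp_eq_thetaSlotImages (pilotDataOfK D K) hlog M archPk archSub Ψ act Mmod region n lat sig split qData tq
    t htq0 htq1 ht0 (norm_realising_eq_of_finrank_eq_one D t r ht0 hT hF) j vQ

end Cor312Prov

end Summit.ABC.IUTFork

end
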